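import Literature.AlgebraicGeometry.Frobenioids.DivisorMonoidCategoryTheoreticityCorSchemaNegative
import Literature.AlgebraicGeometry.Frobenioids.PiNatMonoid
import HarnessLib

/-!
# Frobenioids I, Theorem 4.9, compatibility clause: the universal closure of the INTERFACE-typed
# `PreFrobenioidData.Thm49_compat` is false (FACT-LIST row F-1033, schema); the instance form holds

Mochizuki, *The geometry of Frobenioids I: the general theory*, Kyushu J. Math. **62** (2008) 293–400, §4,
Theorem 4.9, compatibility clause p. 89 ll. 1–2: "`Ψ^Φ` is compatible [when the `C_i` are of isotropic but not
group-like type] with the bijection `Ψ^Prime` of Theorem 4.2 (ii)" [cite: MochizukiFrdI2008, Thm. 4.9 p.89].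

PROOF-ONLY companion (cell abc-iut, block F fact-proving wave, seat abc-iut-f-027 floating on tranche 34; FACT-LIST
row **F-1033** `PreFrobenioidData.Thm49_compat`) of `DivisorMonoidCategoryTheoreticity.lean` (seat abc-iut-L1-t3).
There the clause is typed as a predicate `Thm49_compat S₁ S₂ Ψ E e` on a FREE pair `(E, e)` — an arbitrary family
of monoid isomorphisms `E = "Ψ^Φ"` over `Ψ` and an arbitrary family of bijections of primes `e = "Ψ^Prime"` — over
the bare operations interface `S_i : PreFrobenioidData`. Print asserts it for THE `Ψ^Φ` of Thm. 4.9 and THE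
`Ψ^Prime` of Thm. 4.2 (ii); for a free `(E, e)` it is plainly false, and this file records the kernel `¬ ∀`
(`PreFrobenioidData.not_forall_thm49_compat`, universe `0`): on the degenerate operations on `B(N_{≥1})` of seat
abc-iut-f-032 (`CorSchemaNegative`: `deg_Fr = id`, `Div = 0`, isotropic and not group-like) with divisor monoid
`∏_{Bool} ℤ_{≥0}` (two primes `𝔭_true ≠ 𝔭_false`, `PiNatMonoid.lean`), the identity `E` over `Ψ = 𝟭` together
with the bijection `e` SWAPPING the two primes violates the clause at `e_true ∈ (∏ ℤ_{≥0})_{𝔭_true}`,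
`e_true ∉ (∏ ℤ_{≥0})_{𝔭_false}`. The INSTANCE FORM print asserts — existence of `(Ψ^Φ, Ψ^Prime)` satisfying the
typed clause for Frobenioids `C_i → F_{Φ_i}` under `Thm42Setting`, with no base-type hypothesis — is the tree's
`FrdI.T49.exists_thm49_compat_ofFunctor` (this seat, `Thm49AsPrinted.lean`) / `…_of_isOfFSMType` (abc-iut-w4-d099,
`Thm49CompatOfFunctor.lean`). So F-1033 reads «universal-closure REFUTED; instance form PROVED» (cell rule R5/R1).
No definitions; no statement of the paper is touched or asserted false; nothing here bears on [IUTchIII] Cor. 3.12.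
-/

namespace Literature.AlgebraicGeometry.Frobenioids

open CategoryTheory

namespace PreFrobenioidData

/-- **F-1033 (FACT-LIST), schema negative.** The universal closure of the interface-typed compatibility clause
of Thm. 4.9, `PreFrobenioidData.Thm49_compat S₁ S₂ Ψ E e` — over ALL operations `S_i`, equivalences `Ψ`, monoid
isomorphisms `E` over `Ψ` and bijections of primes `e` — is false: witness the degenerate operations on
`B(N_{≥1})` with `Φ ≡ ∏_{Bool} ℤ_{≥0}` (isotropic, not group-like), `Ψ = 𝟭`, `E = id`, and `e` the transposition
of the two primes. The clause is print's claim only for THE pair `(Ψ^Φ, Ψ^Prime)` it constructs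
(`FrdI.T49.exists_thm49_compat_ofFunctor`). [cite: MochizukiFrdI2008, Thm. 4.9 p.89] -/
theorem not_forall_thm49_compat :
    ¬ ∀ (C₁ : Type) [Category.{0} C₁] (D₁ : Type) [Category.{0} D₁]
        (C₂ : Type) [Category.{0} C₂] (D₂ : Type) [Category.{0} D₂]
        (S₁ : PreFrobenioidData.{0} C₁ D₁) (S₂ : PreFrobenioidData.{0} C₂ D₂) (Ψ : C₁ ≌ C₂)
        (E : DivisorMonoidIsoOver S₁ S₂ Ψ)
        (e : ∀ A : C₁, Primes (S₁.Mon (S₁.base.obj A)) ≃ Primes (S₂.Mon (S₂.base.obj (Ψ.functor.obj A)))),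
        Thm49_compat S₁ S₂ Ψ E e := by
  classical
  intro h
  -- the degenerate operations on `B(N_{≥1})` over the one-object discrete base, `Φ ≡ ∏_{Bool} ℤ_{≥0}`
  let S : PreFrobenioidData.{0} (SingleObj ℕ+) (Discrete PUnit) :=
    { base := (Functor.const _).obj ⟨PUnit.unit⟩
      Mon := fun _ => Multiplicative (Bool → ℕ)
      pull := fun _ => MonoidHom.id _
      pull_id := fun _ _ => rfl
      pull_comp := fun _ _ _ => rfl
      div := fun _ => 1
      degFr := fun φ => φ
      div_id := fun _ => rfl
      div_comp := fun _ _ => by simp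
      degFr_id := fun _ => rfl
      degFr_comp := fun ψ φ => mul_comm (show ℕ+ from φ) (show ℕ+ from ψ) }
  have hdeg : ∀ {x y : SingleObj ℕ+} (φ : x ⟶ y), S.degFr φ = φ := fun _ => rfl
  have hM : ∀ A : SingleObj ℕ+, ∃ m : S.Mon (S.base.obj A), m ≠ 1 :=
    fun _ => ⟨PiNat.single true 1, fun h0 => one_ne_zero (PiNat.single_eq_one_iff.1 h0)⟩
  have hist : S.IsOfIsotropicType := ⟨fun A => CorSchemaNegative.isIsotropic S hdeg A⟩
  have hng : ¬ S.IsOfGroupLikeType := CorSchemaNegative.not_isOfGroupLikeType S hM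
  -- `E = id` over `Ψ = 𝟭`, `e` = the transposition `𝔭_true ↔ 𝔭_false` at every object
  have key := h _ _ _ _ S S CategoryTheory.Equivalence.refl
    { iso := fun _ => MulEquiv.refl _, natural := fun _ _ _ _ => rfl }
    (fun _ => Equiv.swap (PiNat.prime true) (PiNat.prime false))
    hist hist hng hng (SingleObj.star ℕ+) (PiNat.prime true) (PiNat.single true 1)
  have h1 : PiNat.single true 1 ∈ (PiNat.prime (J := Bool) true).submonoid :=
    PiNat.mem_submonoid_prime_iff.2 ⟨1, rfl⟩
  have h2 : PiNat.single true 1 ∉ (PiNat.prime (J := Bool) false).submonoid := by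
    intro hmem
    obtain ⟨k, hk⟩ := PiNat.mem_submonoid_prime_iff.1 hmem
    have hc := congrArg (fun f => PiNat.coeff f true) hk
    simp only [PiNat.coeff_single_same] at hc
    rw [PiNat.coeff_single_of_ne (show true ≠ false by decide)] at hc
    exact one_ne_zero hc
  have h3 : (MulEquiv.refl (Multiplicative (Bool → ℕ))) (PiNat.single true 1) ∈
      (Equiv.swap (PiNat.prime (J := Bool) true) (PiNat.prime false) (PiNat.prime true)).submonoid :=
    key.1 h1
  rw [Equiv.swap_apply_left] at h3
  exact h2 h3

end PreFrobenioidData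

end Literature.AlgebraicGeometry.Frobenioids
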